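import Summits.QuantumFields.YangMills.Theses.FradkinShenkerFlow

/-!
# Sketch — crux-ideate round 2, ideator 4: card `causal-window-relaxation`
(crux stmt-QuantumFields-9441 `FradkinShenkerFlow.SusceptibilityToPoincare`)

Statements only (sorried) + kernel-checked compositions.  The CURRENCY CHANGE: replace the uniform single-link
heat-bath Poincaré inequality UP (a bound on the SLOWEST mode of `L²(μ_{β,S})`, killed by every light conserved
sector: 't Hooft twist for centreless `G`, p76563; mixed-action SU(2), p77766) by WINDOWED LOCAL RELAXATION
`LRW`: the random-scan heat-bath operator `P_S = (#E)⁻¹ ∑_ℓ K_ℓ` (the crux's own one-link kernels) relaxes every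
LOCAL gauge-invariant observable exponentially in heat-bath time `n/#E`, uniformly in `S`, inside the causal window
`n/#E ≤ S`.  `UP ⇒ LRW` (spectral, easy) and `LRW ⇒ EC` (finite speed of propagation, the tree's light cone) —
so the route's open support item 9444 (`PoincareToClustering`) FACTORS through `LRW` (`poincareToClustering_of`,
proved below from the two sorried lemmas), and the successor crux `FS ⇒ LRW` keeps the assembly for EVERY compact
simple `G` (`closes_shape`, proved), with no `SimplyConnectedSpace`/`β₁` surgery.
-/

namespace Summit.QuantumFields.YangMills.Cruxes.SusceptibilityToPoincare.CausalWindowRelaxation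

open MeasureTheory ProbabilityTheory Filter Topology Function
open Literature.MathematicalPhysics.QuantumFieldTheory
open Summit.QuantumFields.YangMills.Theses.FradkinShenkerFlow

noncomputable section

variable {G : Type} [Group G] [TopologicalSpace G] [IsTopologicalGroup G] [CompactSpace G]
  [MeasurableSpace G] [BorelSpace G]

/-- FS(r, β) — verbatim the crux hypothesis. -/
def FS (r : LatticeRep G) (β : ℝ) : Prop :=
  ∀ A B : YMSpecies G, ∃ χ : ℝ, ∀ S : ℕ, ∑ x ∈ Literature.Probability.LatticeModels.box 4 S,
    |covariance (fun U => A.F (Literature.MathematicalPhysics.QuantumLattice.torusLift (2 * S + 1) U))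
      (fun U => B.F (Literature.MathematicalPhysics.QuantumLattice.configShift (-x)
          (Literature.MathematicalPhysics.QuantumLattice.torusLift (2 * S + 1) U)))
      (wilsonMeasure (d := 4) (L := 2 * S + 1) r.ρ β)| ≤ χ

/-- UP(r, β) — verbatim the crux conclusion. -/
def UP (r : LatticeRep G) (β : ℝ) : Prop :=
  ∃ C : ℝ, ∀ S : ℕ, ∀ F : GaugeConfig 4 (2 * S + 1) G → ℝ, Measurable F → (∃ M : ℝ, ∀ U, |F U| ≤ M) →
    variance F (wilsonMeasure (d := 4) (L := 2 * S + 1) r.ρ β) ≤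
      C * ∑ ℓ : Edge 4 (2 * S + 1), ∫ U, ∫ g, (F U - F (Function.update U ℓ g)) ^ 2
        ∂((haarProbability G).tilted (fun g' => -β * wilsonAction r.ρ (Function.update U ℓ g')))
        ∂(wilsonMeasure (d := 4) (L := 2 * S + 1) r.ρ β)

/-- EC(r, β) — verbatim the conclusion of `PoincareToClustering` (volume-uniform exponential clustering in
Euclidean time of the torus Wilson state, `n ≤ S`). -/
def EC (r : LatticeRep G) (β : ℝ) : Prop :=
  ∃ m : ℝ, 0 < m ∧ ∀ A B : YMSpecies G, ∃ C : ℝ, ∀ S n : ℕ, n ≤ S →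
    |latticeConnectedCorr r.ρ β (2 * S + 1) A.F B.F n| ≤ C * Real.exp (-(m * n))

/-- The crux and item 9444 re-read through `FS`/`UP`/`EC` (definitional). -/
theorem crux_iff : SusceptibilityToPoincare ↔
    ∀ (G : Type) [Group G] [TopologicalSpace G] [IsTopologicalGroup G] [CompactSpace G]
      [MeasurableSpace G] [BorelSpace G], IsCompactSimpleLieGroup G →
      ∀ (r : LatticeRep G) (β : ℝ), 0 ≤ β → FS r β → UP r β := Iff.rfl

theorem poincareToClustering_iff : PoincareToClustering ↔
    ∀ (G : Type) [Group G] [TopologicalSpace G] [IsTopologicalGroup G] [CompactSpace G]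
      [MeasurableSpace G] [BorelSpace G], ∀ (r : LatticeRep G) (β : ℝ), 0 ≤ β → UP r β → EC r β := Iff.rfl

/-! ### The new object: the random-scan heat-bath operator and windowed local relaxation -/

/-- **Random-scan single-link heat-bath operator** of the torus Wilson theory, at FUNCTION level:
`(P F)(U) = (#E)⁻¹ ∑_ℓ ∫ F(U[ℓ ↦ g]) dν_ℓ^U(g)`, `ν_ℓ^U = Haar.tilted(−β S_W(U[ℓ ↦ ·]))` — the crux's own one-link
kernels, averaged over the link to refresh.  `μ_{β,S}`-symmetric (each `K_ℓ` is the conditional expectation given the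
links off `ℓ`, tree `HeatBathExchange.lintegral_heatBath_update`), positive, Markov; `#E·(P − 1) = ∑_ℓ (K_ℓ − 1)` is
the continuous-time single-link heat-bath generator whose Dirichlet form is (half) the right-hand side of UP. -/
def hbAvg (r : LatticeRep G) (β : ℝ) (S : ℕ) (F : GaugeConfig 4 (2 * S + 1) G → ℝ) :
    GaugeConfig 4 (2 * S + 1) G → ℝ := fun U =>
  (Fintype.card (Edge 4 (2 * S + 1)) : ℝ)⁻¹ * ∑ ℓ : Edge 4 (2 * S + 1), ∫ g, F (Function.update U ℓ g)
    ∂((haarProbability G).tilted (fun g' => -β * wilsonAction r.ρ (Function.update U ℓ g')))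

/-- **LRW(r, β) — windowed local relaxation** (the proposed successor currency).  There is a rate `γ > 0` such that
for every bounded gauge-invariant LOCAL observable `A` (a `YMSpecies`, read through the periodic lift) there is
`C = C(A, β)` with `Var_{μ_{β,S}}(P_S^n (A∘lift)) ≤ C · exp(−γ · n/#E)` for all `S` and all `n` in the CAUSAL WINDOW
`n ≤ #E · S` (heat-bath time `n/#E ≤ S`: what clustering at distances `≤ S` consumes).  `Var(P^n F) = ‖P^n F − ∫F‖²`
because `P` preserves the mean.  Per-observable constant, uniform rate — exactly the shape of EC. -/
def LRW (r : LatticeRep G) (β : ℝ) : Prop :=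
  ∃ γ : ℝ, 0 < γ ∧ ∀ A : YMSpecies G, ∃ C : ℝ, ∀ S n : ℕ,
    (n : ℝ) ≤ (Fintype.card (Edge 4 (2 * S + 1)) : ℝ) * S →
    variance ((hbAvg r β S)^[n]
        (fun U => A.F (Literature.MathematicalPhysics.QuantumLattice.torusLift (2 * S + 1) U)))
      (wilsonMeasure (d := 4) (L := 2 * S + 1) r.ρ β) ≤
      C * Real.exp (-(γ * n / (Fintype.card (Edge 4 (2 * S + 1)) : ℝ)))

/-- **LR(r, β) — UNWINDOWED local relaxation** (all `n`): recorded only to show the window is load-bearing — LR is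
killed by the SAME light conserved sectors as UP (a local observable's sector spread `ε_S ≍ e^{−σS²}` is a plateau of
`Var(P^n F)` until the tunnelling time `#E·e^{cβS}`, where `C e^{−γ n/#E}` is doubly-exponentially small), LRW is not. -/
def LR (r : LatticeRep G) (β : ℝ) : Prop :=
  ∃ γ : ℝ, 0 < γ ∧ ∀ A : YMSpecies G, ∃ C : ℝ, ∀ S n : ℕ,
    variance ((hbAvg r β S)^[n]
        (fun U => A.F (Literature.MathematicalPhysics.QuantumLattice.torusLift (2 * S + 1) U)))
      (wilsonMeasure (d := 4) (L := 2 * S + 1) r.ρ β) ≤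
      C * Real.exp (-(γ * n / (Fintype.card (Edge 4 (2 * S + 1)) : ℝ)))

theorem lrw_of_lr (r : LatticeRep G) (β : ℝ) (h : LR r β) : LRW r β := by
  obtain ⟨γ, hγ, h⟩ := h
  exact ⟨γ, hγ, fun A => (h A).imp fun C hC S n _ => hC S n⟩

/-! ### First lemmas of the line (statements; sizes in the card) -/

/-- (L1, size S–M, spectral) **UP ⇒ LRW, indeed UP ⇒ LR.**  In `L²(μ)`, `P = 1 + L/#E` with `L = ∑_ℓ (K_ℓ − 1)`,
`K_ℓ` orthogonal projections, so `P` is self-adjoint with spectrum in `[0, 1]`; UP with constant `C` reads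
`Var F ≤ 2C ⟨F, −L F⟩`, i.e. `gap(1 − P) ≥ 1/(2C·#E)`, hence `Var(P^n F) ≤ (1 − 1/(2C#E))^{2n} Var F ≤
e^{−n/(C#E)} · M_A²` for `F = A∘lift` (`|A| ≤ M_A`): LR with `γ = 1/C`.  [deps: HeatBathExchange (symmetry of `K_ℓ`),
`condExpL2`/`starProjection` bookkeeping of tree `WilsonBlockHeatBathL2`] -/
theorem lr_of_up (r : LatticeRep G) (β : ℝ) (h : UP r β) : LR r β := by
  sorry

/-- (L2, size L, finite speed of propagation) **LRW ⇒ EC.**  For local `A`, `B` at Euclidean-time distance `n ≤ S`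
run the random-scan heat bath for `k = ⌊ε n⌋ · #E` steps: (pull-out) `Cov(A∘lift, τ_nB∘lift) = Cov(P^k_{Λ_A} A, P^k_{Λ_B} τ_nB)`
EXACTLY for the dynamics restricted to far-apart link sets `Λ_A, Λ_B` (each `K_ℓ` is `μ`-symmetric and fixes functions
of the links off `ℓ`; the tree's `GapToClustering.abs_latticeConnectedCorr_le_of_globalPoincare` is this argument for
the block sampler); (light cone) `‖P^k F − P^k_Λ F‖ ≤ 2‖F‖ |supp| (18 e k/(#E D))^D / …` by path counting on the
degree-18 link-influence graph, super-exponentially small for `D ≍ n/4 ≥ 36 ε n`; (relaxation) LRW inside the window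
`k/#E = εn ≤ S` gives `‖P^k F − ∫F‖ ≤ √C_A e^{−γ ε n/2}`; Cauchy–Schwarz.  Rate `m = min(γε/2, …) > 0` chosen before
`A, B`; small `n` absorbed by the a priori bound `2 M_A M_B` (tree `abs_latticeConnectedCorr_le_two_mul`). -/
theorem ec_of_lrw (r : LatticeRep G) (β : ℝ) (h : LRW r β) : EC r β := by
  sorry

/-! ### Kernel-checked compositions -/

omit [IsTopologicalGroup G] [CompactSpace G] [BorelSpace G] in
/-- Item 9444 `PoincareToClustering` FACTORS through the new currency: `(UP ⇒ LR(W)) → (LRW ⇒ EC) → 9444`. -/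
theorem poincareToClustering_of
    (h₁ : ∀ (G : Type) [Group G] [TopologicalSpace G] [IsTopologicalGroup G] [CompactSpace G]
      [MeasurableSpace G] [BorelSpace G] (r : LatticeRep G) (β : ℝ), UP r β → LR r β)
    (h₂ : ∀ (G : Type) [Group G] [TopologicalSpace G] [IsTopologicalGroup G] [CompactSpace G]
      [MeasurableSpace G] [BorelSpace G] (r : LatticeRep G) (β : ℝ), LRW r β → EC r β) :
    PoincareToClustering :=
  fun G _ _ _ _ _ _ r β _ hUP => h₂ G r β (lrw_of_lr r β (h₁ G r β hUP))

/-- **The proposed successor of the crux** (for the tenure planner; NOT a restatement by this seat):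
finite gauge-invariant susceptibility ⇒ windowed local relaxation, for EVERY compact simple `G` (centreless included),
every faithful `r`, every `β ≥ 0`.  Immune by construction to conserved-sector bottlenecks (they are invisible to local
observables at precision `e^{−σS²} ≪ e^{−γS}`); carries the same infrared ("no massless non-abelian phase in d = 4")
content as the crux; its d = 5 twin is false (FS₅ true, LRW₅ false in the Coulomb phase), as it must be. -/
def SusceptibilityToRelaxation : Prop :=
  ∀ (G : Type) [Group G] [TopologicalSpace G] [IsTopologicalGroup G] [CompactSpace G]
    [MeasurableSpace G] [BorelSpace G], IsCompactSimpleLieGroup G →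
    ∀ (r : LatticeRep G) (β : ℝ), 0 ≤ β → FS r β → LRW r β

/-- `RelaxationToClustering` — the successor of item 9444 (= lemma L2 quantified). -/
def RelaxationToClustering : Prop :=
  ∀ (G : Type) [Group G] [TopologicalSpace G] [IsTopologicalGroup G] [CompactSpace G]
    [MeasurableSpace G] [BorelSpace G], ∀ (r : LatticeRep G) (β : ℝ), 0 ≤ β → LRW r β → EC r β

omit [IsTopologicalGroup G] [CompactSpace G] [BorelSpace G] in
/-- The successor is WEAKER than the crux (given L1): honest — this is a currency change, not a Transfer. -/
theorem susceptibilityToRelaxation_of_crux (hcrux : SusceptibilityToPoincare)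
    (h₁ : ∀ (G : Type) [Group G] [TopologicalSpace G] [IsTopologicalGroup G] [CompactSpace G]
      [MeasurableSpace G] [BorelSpace G] (r : LatticeRep G) (β : ℝ), UP r β → LR r β) :
    SusceptibilityToRelaxation :=
  fun G _ _ _ _ _ _ hG r β hβ hFS => lrw_of_lr r β (h₁ G r β (crux_iff.1 hcrux G hG r β hβ hFS))

omit [IsTopologicalGroup G] [CompactSpace G] [BorelSpace G] in
/-- **The assembly survives the currency change for EVERY compact simple `G`** — same shape as the route's `closes`,
with `SusceptibilityToPoincare`/`PoincareToClustering` replaced by their LRW successors; no `SimplyConnectedSpace`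
re-scoping of cruxes 3–4, no covering-transfer item. -/
theorem closes_shape (hSR : SusceptibilityToRelaxation) (hRC : RelaxationToClustering)
    (hFS : FiniteSusceptibilityWeakCoupling) (hCY : ClusteringToYangMills) : YangMills := by
  refine hCY ?_
  intro G _ _ _ _ _ _ hG r
  obtain ⟨β₀, hβ₀⟩ := hFS G hG r
  refine ⟨max β₀ 0, fun β hβ => ?_⟩
  have h0 : (0 : ℝ) ≤ β := le_trans (le_max_right _ _) hβ
  exact hRC G r β h0 (hSR G hG r β h0 (hβ₀ β (le_trans (le_max_left _ _) hβ)))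

end

end Summit.QuantumFields.YangMills.Cruxes.SusceptibilityToPoincare.CausalWindowRelaxation

/-! ### Appendix: the successor items as ONE-LINE Props over existing declarations (no helper defs)
exactly as `ledger workitem add --signature` / `route edit --restate` would file them; definitional agreement with
`SusceptibilityToRelaxation` / `RelaxationToClustering` above is checked by `Iff.rfl`. -/

namespace Summit.QuantumFields.YangMills.Theses.FradkinShenkerFlow.SuccessorSignatures
open Summit.QuantumFields.YangMills.Theses.FradkinShenkerFlow

/-- candidate `SusceptibilityToRelaxation` (successor of 9441): FS ⇒ LRW, every compact simple G, r, β ≥ 0. -/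
def SusceptibilityToRelaxationSig : Prop :=
  ∀ (G : Type) [Group G] [TopologicalSpace G] [IsTopologicalGroup G] [CompactSpace G] [MeasurableSpace G] [BorelSpace G], Literature.MathematicalPhysics.QuantumFieldTheory.IsCompactSimpleLieGroup G → ∀ (r : Literature.MathematicalPhysics.QuantumFieldTheory.LatticeRep G) (β : ℝ), 0 ≤ β → (∀ A B : Literature.MathematicalPhysics.QuantumFieldTheory.YMSpecies G, ∃ χ : ℝ, ∀ S : ℕ, ∑ x ∈ Literature.Probability.LatticeModels.box 4 S, |ProbabilityTheory.covariance (fun U => A.F (Literature.MathematicalPhysics.QuantumLattice.torusLift (2 * S + 1) U)) (fun U => B.F (Literature.MathematicalPhysics.QuantumLattice.configShift (-x) (Literature.MathematicalPhysics.QuantumLattice.torusLift (2 * S + 1) U))) (Literature.MathematicalPhysics.QuantumFieldTheory.wilsonMeasure (d := 4) (L := 2 * S + 1) r.ρ β)| ≤ χ) → ∃ γ : ℝ, 0 < γ ∧ ∀ A : Literature.MathematicalPhysics.QuantumFieldTheory.YMSpecies G, ∃ C : ℝ, ∀ S n : ℕ, (n : ℝ) ≤ (Fintype.card (Literature.MathematicalPhysics.QuantumFieldTheory.Edge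 4 (2 * S + 1)) : ℝ) * S → ProbabilityTheory.variance ((fun (F : Literature.MathematicalPhysics.QuantumFieldTheory.GaugeConfig 4 (2 * S + 1) G → ℝ) (U : Literature.MathematicalPhysics.QuantumFieldTheory.GaugeConfig 4 (2 * S + 1) G) => (Fintype.card (Literature.MathematicalPhysics.QuantumFieldTheory.Edge 4 (2 * S + 1)) : ℝ)⁻¹ * ∑ ℓ : Literature.MathematicalPhysics.QuantumFieldTheory.Edge 4 (2 * S + 1), ∫ g, F (Function.update U ℓ g) ∂((Literature.MathematicalPhysics.QuantumFieldTheory.haarProbability G).tilted (fun g' => -β * Literature.MathematicalPhysics.QuantumFieldTheory.wilsonAction r.ρ (Function.update U ℓ g'))))^[n] (fun U => A.F (Literature.MathematicalPhysics.QuantumLattice.torusLift (2 * S + 1) U))) (Literature.MathematicalPhysics.QuantumFieldTheory.wilsonMeasure (d := 4) (L := 2 * S + 1) r.ρ β) ≤ C * Real.exp (-(γ * n / (Fintype.card (Literature.MathematicalPhysics.QuantumFieldTheory.Edge 4 (2 * S + 1)) : ℝ)))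

/-- candidate `RelaxationToClustering` (successor of 9444): LRW ⇒ EC, every compact G with a LatticeRep, β ≥ 0. -/
def RelaxationToClusteringSig : Prop :=
  ∀ (G : Type) [Group G] [TopologicalSpace G] [IsTopologicalGroup G] [CompactSpace G] [MeasurableSpace G] [BorelSpace G], ∀ (r : Literature.MathematicalPhysics.QuantumFieldTheory.LatticeRep G) (β : ℝ), 0 ≤ β → (∃ γ : ℝ, 0 < γ ∧ ∀ A : Literature.MathematicalPhysics.QuantumFieldTheory.YMSpecies G, ∃ C : ℝ, ∀ S n : ℕ, (n : ℝ) ≤ (Fintype.card (Literature.MathematicalPhysics.QuantumFieldTheory.Edge 4 (2 * S + 1)) : ℝ) * S → ProbabilityTheory.variance ((fun (F : Literature.MathematicalPhysics.QuantumFieldTheory.GaugeConfig 4 (2 * S + 1) G → ℝ) (U : Literature.MathematicalPhysics.QuantumFieldTheory.GaugeConfig 4 (2 * S + 1) G) => (Fintype.card (Literature.MathematicalPhysics.QuantumFieldTheory.Edge 4 (2 * S + 1)) : ℝ)⁻¹ * ∑ ℓ : Literature.MathematicalPhysics.QuantumFieldTheory.Edge 4 (2 * S + 1), ∫ g, F (Function.update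 U ℓ g) ∂((Literature.MathematicalPhysics.QuantumFieldTheory.haarProbability G).tilted (fun g' => -β * Literature.MathematicalPhysics.QuantumFieldTheory.wilsonAction r.ρ (Function.update U ℓ g'))))^[n] (fun U => A.F (Literature.MathematicalPhysics.QuantumLattice.torusLift (2 * S + 1) U))) (Literature.MathematicalPhysics.QuantumFieldTheory.wilsonMeasure (d := 4) (L := 2 * S + 1) r.ρ β) ≤ C * Real.exp (-(γ * n / (Fintype.card (Literature.MathematicalPhysics.QuantumFieldTheory.Edge 4 (2 * S + 1)) : ℝ)))) → (∃ m : ℝ, 0 < m ∧ ∀ A B : Literature.MathematicalPhysics.QuantumFieldTheory.YMSpecies G, ∃ C : ℝ, ∀ S n : ℕ, n ≤ S → |Literature.MathematicalPhysics.QuantumFieldTheory.latticeConnectedCorr r.ρ β (2 * S + 1) A.F B.F n| ≤ C * Real.exp (-(m * n)))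

/-- the deciding theorem keeps its shape and reaches `YangMills` for every compact simple `G`. -/
theorem closes_sig (hSR : SusceptibilityToRelaxationSig) (hRC : RelaxationToClusteringSig)
    (hFS : FiniteSusceptibilityWeakCoupling) (hCY : ClusteringToYangMills) : YangMills := by
  refine hCY ?_
  intro G _ _ _ _ _ _ hG r
  obtain ⟨β₀, hβ₀⟩ := hFS G hG r
  refine ⟨max β₀ 0, fun β hβ => ?_⟩
  have h0 : (0 : ℝ) ≤ β := le_trans (le_max_right _ _) hβ
  exact hRC G r β h0 (hSR G hG r β h0 (hβ₀ β (le_trans (le_max_left _ _) hβ)))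

/-- and the two inline Props agree definitionally with the Sketch's `FS → LRW` / `LRW → EC`. -/
example : SusceptibilityToRelaxationSig ↔
    Summit.QuantumFields.YangMills.Cruxes.SusceptibilityToPoincare.CausalWindowRelaxation.SusceptibilityToRelaxation :=
  Iff.rfl

example : RelaxationToClusteringSig ↔
    Summit.QuantumFields.YangMills.Cruxes.SusceptibilityToPoincare.CausalWindowRelaxation.RelaxationToClustering :=
  Iff.rfl

end Summit.QuantumFields.YangMills.Theses.FradkinShenkerFlow.SuccessorSignatures

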